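import Summits.Schanuel.Schanuel.Theorems.RootDecomp1KGapCell01

/-!
# RootDecomp1KGapCell — lens 1, generation 42 «GAP CELL / INTERLACED SPECIALISATION» (lane K-R26 (α-loc)): the walls (1, ℓ_b, ρ), (1, ℓ₂, ℓ₃, ρ) (mod hNW), their π-twins and the 31077 pair (ℓ_b, ρ) HYPOTHESIS-FREE for every ρ ∈ `FactorialGapLiouville` — located order data strictly below the log-log floor; member ρ_W — continuation (RootDecomp1KGapCell02): §2a ENGINE PARTS (context-free sub-lemmas: slices, slot coefficients, `clearPoly`, the gap step, the height/error balance)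

(lens-1 g42 `GapCell.lean` EDITION 3 [HOME/decomp-schanuel-lens-1/g42/ sha256 6f7828b1…, 2470 l; VERDICT L2004, EDITIONS 2+3 L2018, ACK L2023]; port by census-1 gen 17 as
`RootDecomp1KGapCell01`–`10` — see the PORT NOTE of part 01; `--supports stmt-Schanuel-33364` (04: `stmt-Schanuel-31077`); rung 0.)
-/

open Summit.Schanuel.Schanuel.Theorems.RootDecomp1KHyper
open Summit.Schanuel.Schanuel.Theorems.RootDecomp1KHyper.HyperCell
open Summit.Schanuel.Schanuel.Theorems.RootDecomp1KRelLiouvilleCell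
open Summit.Schanuel.Schanuel.Theorems.RootDecomp1KLogLogCell
open Summit.Schanuel.Schanuel.Theorems.RootDecomp1KTwoBaseCell
open LiouvilleNumber
open scoped Nat

namespace Summit.Schanuel.Schanuel.Theorems.RootDecomp1KGapCell

variable {k n : ℕ}

/-- `mvlen (c·X^m) ≤ |c|` (tree twin). -/
private theorem mvlen_monomial_le'' (m : Fin n →₀ ℕ) (c : ℤ) :
    mvlen (MvPolynomial.monomial m c) ≤ |c| := by
  classical
  rw [mvlen_eq_sum_of_support_subset _ MvPolynomial.support_monomial_subset, Finset.sum_singleton,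
    MvPolynomial.coeff_monomial, if_pos rfl]

/-- Subadditivity of `mvlen` (tree twin). -/
private theorem mvlen_add_le'' (P Q : MvPolynomial (Fin n) ℤ) : mvlen (P + Q) ≤ mvlen P + mvlen Q := by
  classical
  have hs : (P + Q).support ⊆ P.support ∪ Q.support := MvPolynomial.support_add
  rw [mvlen_eq_sum_of_support_subset _ hs,
    mvlen_eq_sum_of_support_subset P (Finset.subset_union_left (s₂ := Q.support)),
    mvlen_eq_sum_of_support_subset Q (Finset.subset_union_right (s₁ := P.support)),
    ← Finset.sum_add_distrib]
  exact Finset.sum_le_sum fun m _ => by rw [MvPolynomial.coeff_add]; exact abs_add_le _ _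

/-- `mvlen (Σ F_i) ≤ Σ mvlen F_i` (tree twin). -/
private theorem mvlen_sum_le'' {ι : Type*} (s : Finset ι) (F : ι → MvPolynomial (Fin n) ℤ) :
    mvlen (∑ i ∈ s, F i) ≤ ∑ i ∈ s, mvlen (F i) := by
  classical
  induction s using Finset.induction_on with
  | empty => simp [mvlen]
  | insert a s ha ih =>
    rw [Finset.sum_insert ha, Finset.sum_insert ha]
    exact (mvlen_add_le'' _ _).trans (by linarith)

/-! ## §2  THE GAP ENGINE: `FactorialGapLiouville ρ` + injective-weight base block + `MvPolyMeasure θ⃗` ⇒ algebraic independence -/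

section Engine
variable {k n : ℕ}

/-! ### §2a  ENGINE PARTS (EDITION 3 — proof-only reshape for the port's part cap; every statement of §1–§10 is
unchanged).  The engine's intermediate objects as top-level definitions — the slice set `S₀(e₀)`, the block slice
`q(e₀) ∈ ℝ[Y⃗]`, the slot coefficients `P_e · ∏ p_i^{e_{ι i}} B_i^{d − e_{ι i}}` (all slots: the cleared
coefficients `c_e`; block slots: `bc_e`), the cleared polynomial `H ∈ ℤ[X_θ]`, the `ρ`-slices `κ_j(e₀)` — with
their context-free lemmas: casts and bounds, the value `H(θ) = D · P(s', θ)`, degree and length of `H`, the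
regrouping of the `tpart e₀`-coefficient of `H` by the `ρ`-exponent, THE GAP non-vanishing step (tree Lemma A
`mvspecialise_ne_zero_of_coprime` in the `ρ`-slot), the threshold, the gap arithmetic and the final balance. -/

/-- `S₀(e₀)`: the support exponents of `P` with the same `θ`-part as `e₀`. -/
noncomputable def sliceSet (P : MvPolynomial (Fin (k + 1) ⊕ Fin n) ℤ) (e₀ : Fin (k + 1) ⊕ Fin n →₀ ℕ) :
    Finset (Fin (k + 1) ⊕ Fin n →₀ ℕ) :=
  P.support.filter (fun e => tpart e = tpart e₀)

/-- `S₀(e₀) ⊆ supp P`. -/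
theorem sliceSet_subset (P : MvPolynomial (Fin (k + 1) ⊕ Fin n) ℤ) (e₀ : Fin (k + 1) ⊕ Fin n →₀ ℕ) :
    sliceSet P e₀ ⊆ P.support := Finset.filter_subset _ _

/-- The block slice `q(e₀) = Σ_{e ∈ S₀(e₀), e₀-slot equal} P_e · Y^{tail (lpart e)} ∈ ℝ[Y_1, …, Y_k]`. -/
noncomputable def blockSlice (P : MvPolynomial (Fin (k + 1) ⊕ Fin n) ℤ) (e₀ : Fin (k + 1) ⊕ Fin n →₀ ℕ) :
    MvPolynomial (Fin k) ℝ :=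
  ∑ e ∈ (sliceSet P e₀).filter (fun e => e (Sum.inl 0) = e₀ (Sum.inl 0)),
    MvPolynomial.monomial (lpart e).tail ((P.coeff e : ℤ) : ℝ)

/-- The block slice at a support exponent is non-zero (exponents of one slice with equal `ρ`-slot have distinct
tails). -/
theorem blockSlice_ne_zero {P : MvPolynomial (Fin (k + 1) ⊕ Fin n) ℤ} {e₀ : Fin (k + 1) ⊕ Fin n →₀ ℕ}
    (he₀ : e₀ ∈ P.support) : blockSlice P e₀ ≠ 0 := by
  classical
  have he₀S : e₀ ∈ (sliceSet P e₀).filter (fun e => e (Sum.inl 0) = e₀ (Sum.inl 0)) :=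
    Finset.mem_filter.mpr ⟨Finset.mem_filter.mpr ⟨he₀, rfl⟩, rfl⟩
  have hinjS : ∀ e ∈ (sliceSet P e₀).filter (fun e => e (Sum.inl 0) = e₀ (Sum.inl 0)),
      (lpart e).tail = (lpart e₀).tail → e = e₀ := by
    intro e he htl
    have he1 := Finset.mem_filter.mp he
    have hhead : lpart e 0 = lpart e₀ 0 := by rw [lpart_apply, lpart_apply, he1.2]
    have hl : lpart e = lpart e₀ := by
      rw [← Finsupp.cons_tail (lpart e), ← Finsupp.cons_tail (lpart e₀), hhead, htl]
    exact eq_of_parts_eq hl (Finset.mem_filter.mp he1.1).2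
  intro h
  have hc : (blockSlice P e₀).coeff (lpart e₀).tail = ((P.coeff e₀ : ℤ) : ℝ) := by
    rw [blockSlice, MvPolynomial.coeff_sum, Finset.sum_eq_single e₀]
    · rw [MvPolynomial.coeff_monomial, if_pos rfl]
    · intro e he hne
      rw [MvPolynomial.coeff_monomial, if_neg]
      intro hl
      exact hne (hinjS e he hl)
    · intro h0; exact absurd he₀S h0
  rw [h, MvPolynomial.coeff_zero] at hc
  exact (MvPolynomial.mem_support_iff.mp he₀) (by exact_mod_cast hc.symm)

/-- The slot coefficient `P_e · ∏_i p_i^{e_{ι i}} · B_i^{d − e_{ι i}}` for a slot map `ι : Fin m → Fin (k+1)`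
(`ι = id`: the cleared coefficient `c_e`; `ι = Fin.succ`: the block coefficient `bc_e`). -/
noncomputable def slotCoeff (P : MvPolynomial (Fin (k + 1) ⊕ Fin n) ℤ) (d : ℕ) {m : ℕ}
    (ι : Fin m → Fin (k + 1)) (pZ BZ : Fin m → ℤ) (e : Fin (k + 1) ⊕ Fin n →₀ ℕ) : ℤ :=
  P.coeff e * ∏ i, (pZ i ^ e (Sum.inl (ι i)) * BZ i ^ (d - e (Sum.inl (ι i))))

/-- The cleared polynomial `H = Σ_{e ∈ supp P} c_e · X^{tpart e} ∈ ℤ[X_θ]` (`= D · P(s', X)`, `D = ∏ B_i^d`). -/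
noncomputable def clearPoly (P : MvPolynomial (Fin (k + 1) ⊕ Fin n) ℤ) (d : ℕ) (p' B' : Fin (k + 1) → ℤ) :
    MvPolynomial (Fin n) ℤ :=
  ∑ e ∈ P.support, MvPolynomial.monomial (tpart e) (slotCoeff P d (fun i => i) p' B' e)

/-- The `ρ`-slice `κ_j(e₀) = Σ_{e ∈ S₀(e₀), e(ρ-slot) = j} bc_e`. -/
noncomputable def sliceSum (P : MvPolynomial (Fin (k + 1) ⊕ Fin n) ℤ) (d : ℕ) (pZ BZ : Fin k → ℤ)
    (e₀ : Fin (k + 1) ⊕ Fin n →₀ ℕ) (j : ℕ) : ℤ :=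
  ∑ e ∈ (sliceSet P e₀).filter (fun e => e (Sum.inl 0) = j), slotCoeff P d Fin.succ pZ BZ e

/-- Clearing denominators: `P_e ∏ p_i^{e_{ι i}} B_i^{d−e_{ι i}} = P_e · (∏ B_i^d) · ∏ s_i^{e_{ι i}}` for
`s_i = p_i / B_i`. -/
theorem slotCoeff_cast {m : ℕ} {P : MvPolynomial (Fin (k + 1) ⊕ Fin n) ℤ} {d : ℕ} (ι : Fin m → Fin (k + 1))
    {e : Fin (k + 1) ⊕ Fin n →₀ ℕ} (hdeg : ∀ i, e (Sum.inl (ι i)) ≤ d) {pZ BZ : Fin m → ℤ}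
    (hBpos : ∀ i, (0 : ℝ) < BZ i) {s : Fin m → ℝ} (hsp : ∀ i, s i = (pZ i : ℝ) / (BZ i : ℝ)) :
    ((slotCoeff P d ι pZ BZ e : ℤ) : ℝ) =
      ((P.coeff e : ℤ) : ℝ) * (∏ i, ((BZ i : ℤ) : ℝ) ^ d) * ∏ i, s i ^ e (Sum.inl (ι i)) := by
  rw [slotCoeff]; push_cast
  rw [mul_assoc, ← Finset.prod_mul_distrib]
  congr 1
  refine Finset.prod_congr rfl fun i _ => ?_
  obtain ⟨t, ht⟩ := Nat.exists_eq_add_of_le (hdeg i)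
  have hB : ((BZ i : ℤ) : ℝ) ^ e (Sum.inl (ι i)) ≠ 0 := pow_ne_zero _ (hBpos i).ne'
  rw [hsp i, ht, Nat.add_sub_cancel_left, pow_add, div_pow, mul_div_assoc', eq_div_iff hB]
  ring

/-- The height of a slot coefficient: `|p_i| ≤ R_b B_i` (`R_b ≥ 1`) gives `|·| ≤ |P_e| · R_b^d · ∏ B_i^d`. -/
theorem slotCoeff_abs {m : ℕ} {P : MvPolynomial (Fin (k + 1) ⊕ Fin n) ℤ} {d : ℕ} (ι : Fin m → Fin (k + 1))
    {e : Fin (k + 1) ⊕ Fin n →₀ ℕ} (hdeg : ∀ i, e (Sum.inl (ι i)) ≤ d)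
    (hdegS : ∑ i, e (Sum.inl (ι i)) ≤ d) {pZ BZ : Fin m → ℤ} (hBpos : ∀ i, (0 : ℝ) < BZ i)
    {Rb : ℝ} (hRb1 : 1 ≤ Rb) (hp_abs : ∀ i, |(pZ i : ℝ)| ≤ Rb * BZ i) :
    |((slotCoeff P d ι pZ BZ e : ℤ) : ℝ)| ≤
      |((P.coeff e : ℤ) : ℝ)| * (Rb ^ d * ∏ i, ((BZ i : ℤ) : ℝ) ^ d) := by
  rw [slotCoeff]; push_cast
  rw [abs_mul, Finset.abs_prod]
  refine mul_le_mul_of_nonneg_left ?_ (abs_nonneg _)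
  have hD0 : (0 : ℝ) ≤ ∏ i, ((BZ i : ℤ) : ℝ) ^ d := Finset.prod_nonneg fun i _ => pow_nonneg (hBpos i).le _
  have hterm : ∀ i, |(pZ i : ℝ) ^ e (Sum.inl (ι i)) * ((BZ i : ℤ) : ℝ) ^ (d - e (Sum.inl (ι i)))| ≤
      Rb ^ e (Sum.inl (ι i)) * ((BZ i : ℤ) : ℝ) ^ d := by
    intro i
    rw [abs_mul, abs_pow, abs_of_nonneg (pow_nonneg (hBpos i).le _)]
    obtain ⟨t, ht⟩ := Nat.exists_eq_add_of_le (hdeg i)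
    rw [ht, Nat.add_sub_cancel_left, pow_add, ← mul_assoc]
    refine mul_le_mul_of_nonneg_right ?_ (pow_nonneg (hBpos i).le _)
    rw [← mul_pow]
    exact pow_le_pow_left₀ (abs_nonneg _) (hp_abs i) _
  calc ∏ i, |(pZ i : ℝ) ^ e (Sum.inl (ι i)) * ((BZ i : ℤ) : ℝ) ^ (d - e (Sum.inl (ι i)))|
      ≤ ∏ i, Rb ^ e (Sum.inl (ι i)) * ((BZ i : ℤ) : ℝ) ^ d :=
        Finset.prod_le_prod (fun i _ => abs_nonneg _) fun i _ => hterm i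
    _ = Rb ^ (∑ i, e (Sum.inl (ι i))) * ∏ i, ((BZ i : ℤ) : ℝ) ^ d := by
        rw [Finset.prod_mul_distrib, Finset.prod_pow_eq_pow_sum]
    _ ≤ Rb ^ d * ∏ i, ((BZ i : ℤ) : ℝ) ^ d := by
        refine mul_le_mul_of_nonneg_right ?_ hD0
        exact pow_le_pow_right₀ hRb1 hdegS

/-- Slot `0` split off: `c_e = a^{e_0} q^{d − e_0} · bc_e` for `p' = (a, p⃗)`, `B' = (q, B⃗)`. -/
theorem slotCoeff_cons (P : MvPolynomial (Fin (k + 1) ⊕ Fin n) ℤ) (d : ℕ) (a q : ℤ) (pZ BZ : Fin k → ℤ)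
    (e : Fin (k + 1) ⊕ Fin n →₀ ℕ) :
    slotCoeff P d (fun i => i) (Fin.cons a pZ) (Fin.cons q BZ) e =
      a ^ e (Sum.inl 0) * q ^ (d - e (Sum.inl 0)) * slotCoeff P d Fin.succ pZ BZ e := by
  simp only [slotCoeff]
  rw [Fin.prod_univ_succ]
  simp only [Fin.cons_zero, Fin.cons_succ]
  ring

/-- The coefficients of `H`: `H_α = Σ_{e ∈ supp P, tpart e = α} c_e`. -/
theorem coeff_clearPoly (P : MvPolynomial (Fin (k + 1) ⊕ Fin n) ℤ) (d : ℕ) (p' B' : Fin (k + 1) → ℤ)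
    (α : Fin n →₀ ℕ) :
    (clearPoly P d p' B').coeff α =
      ∑ e ∈ P.support.filter (fun e => tpart e = α), slotCoeff P d (fun i => i) p' B' e := by
  classical
  rw [clearPoly, MvPolynomial.coeff_sum, Finset.sum_filter]
  refine Finset.sum_congr rfl fun e _ => ?_
  rw [MvPolynomial.coeff_monomial]

/-- The value of `H`: `H(θ) = D · P(s', θ)` with `D = ∏ B'_i^d`, `s'_i = p'_i / B'_i`. -/
theorem aeval_clearPoly {P : MvPolynomial (Fin (k + 1) ⊕ Fin n) ℤ} {d : ℕ}
    (hdegl : ∀ e ∈ P.support, ∀ i, e (Sum.inl i) ≤ d) {p' B' : Fin (k + 1) → ℤ}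
    (hBpos : ∀ i, (0 : ℝ) < B' i) {s' : Fin (k + 1) → ℝ} (hsp' : ∀ i, s' i = (p' i : ℝ) / (B' i : ℝ))
    (θ : Fin n → ℂ) :
    MvPolynomial.aeval θ (clearPoly P d p' B') =
      ((∏ i, ((B' i : ℤ) : ℝ) ^ d : ℝ) : ℂ) *
        MvPolynomial.aeval (Sum.elim (fun i => ((s' i : ℝ) : ℂ)) θ) P := by
  rw [clearPoly, map_sum, MvPolynomial.aeval_def (Sum.elim (fun i => ((s' i : ℝ) : ℂ)) θ),
    MvPolynomial.eval₂_eq', Finset.mul_sum]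
  refine Finset.sum_congr rfl fun e he => ?_
  rw [MvPolynomial.aeval_monomial, Finsupp.prod_fintype _ _ (fun _ => pow_zero _),
    Fintype.prod_sum_type]
  simp only [tpart_apply, Sum.elim_inl, Sum.elim_inr, algebraMap_int_eq, eq_intCast]
  have h1 : ((slotCoeff P d (fun i => i) p' B' e : ℤ) : ℂ) =
      (((slotCoeff P d (fun i => i) p' B' e : ℤ) : ℝ) : ℂ) := by push_cast; rfl
  rw [h1, slotCoeff_cast (fun i => i) (fun i => hdegl e he i) hBpos hsp']
  push_cast
  ring

/-- The degree of `H` is at most `d` (`d` bounds the `θ`-degrees of `P`). -/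
theorem totalDegree_clearPoly_le {P : MvPolynomial (Fin (k + 1) ⊕ Fin n) ℤ} {d : ℕ}
    (hdegT : ∀ e ∈ P.support, ∑ j, e (Sum.inr j) ≤ d) (p' B' : Fin (k + 1) → ℤ) :
    (clearPoly P d p' B').totalDegree ≤ d := by
  rw [clearPoly]
  refine MvPolynomial.totalDegree_finsetSum_le fun e he => ?_
  refine (MvPolynomial.totalDegree_monomial_le _ _).trans ?_
  rw [Finsupp.sum_fintype _ _ (fun _ => rfl)]
  simp only [tpart_apply, id]
  exact hdegT e he

/-- The length of `H`: `len H ≤ R_b^d · D · L` (`L = Σ |P_e|`). -/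
theorem mvlen_clearPoly_le {P : MvPolynomial (Fin (k + 1) ⊕ Fin n) ℤ} {d : ℕ}
    (hdegl : ∀ e ∈ P.support, ∀ i, e (Sum.inl i) ≤ d) (hdegL : ∀ e ∈ P.support, ∑ i, e (Sum.inl i) ≤ d)
    {p' B' : Fin (k + 1) → ℤ} (hBpos : ∀ i, (0 : ℝ) < B' i) {Rb : ℝ} (hRb1 : 1 ≤ Rb)
    (hp'_abs : ∀ i, |(p' i : ℝ)| ≤ Rb * B' i) :
    (mvlen (clearPoly P d p' B') : ℝ) ≤
      Rb ^ d * (∏ i, ((B' i : ℤ) : ℝ) ^ d) * ∑ e ∈ P.support, |((P.coeff e : ℤ) : ℝ)| := by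
  have h1 : mvlen (clearPoly P d p' B') ≤ ∑ e ∈ P.support, |slotCoeff P d (fun i => i) p' B' e| := by
    rw [clearPoly]
    exact (mvlen_sum_le'' _ _).trans (Finset.sum_le_sum fun e _ => mvlen_monomial_le'' _ _)
  have h2 : (mvlen (clearPoly P d p' B') : ℝ) ≤
      ∑ e ∈ P.support, |((slotCoeff P d (fun i => i) p' B' e : ℤ) : ℝ)| := by
    have := (Int.cast_le (R := ℝ)).mpr h1; push_cast at this; exact this
  refine h2.trans ?_
  rw [Finset.mul_sum]
  refine Finset.sum_le_sum fun e he => ?_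
  calc |((slotCoeff P d (fun i => i) p' B' e : ℤ) : ℝ)|
      ≤ |((P.coeff e : ℤ) : ℝ)| * (Rb ^ d * ∏ i, ((B' i : ℤ) : ℝ) ^ d) :=
        slotCoeff_abs (fun i => i) (fun i => hdegl e he i) (hdegL e he) hBpos hRb1 hp'_abs
    _ = Rb ^ d * (∏ i, ((B' i : ℤ) : ℝ) ^ d) * |((P.coeff e : ℤ) : ℝ)| := by ring

/-- The `tpart e₀`-coefficient of `H` with slot `0 ↦ (a, q)`, regrouped by the `ρ`-exponent:
`H_{α₀} = Σ_{j ≤ d} a^j q^{d−j} κ_j`. -/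
theorem coeff_clearPoly_regroup {P : MvPolynomial (Fin (k + 1) ⊕ Fin n) ℤ} {d : ℕ}
    (hdegl0 : ∀ e ∈ P.support, e (Sum.inl 0) ≤ d) (a q : ℤ) (pZ BZ : Fin k → ℤ)
    (e₀ : Fin (k + 1) ⊕ Fin n →₀ ℕ) :
    (clearPoly P d (Fin.cons a pZ) (Fin.cons q BZ)).coeff (tpart e₀) =
      ∑ j ∈ Finset.range (d + 1), (a ^ j * q ^ (d - j)) * sliceSum P d pZ BZ e₀ j := by
  rw [coeff_clearPoly]
  change ∑ e ∈ sliceSet P e₀, _ = _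
  rw [← Finset.sum_fiberwise_of_maps_to (s := sliceSet P e₀) (t := Finset.range (d + 1))
    (g := fun e => e (Sum.inl 0))
    (fun e he => Finset.mem_range.mpr (Nat.lt_succ_of_le (hdegl0 e (sliceSet_subset P e₀ he))))]
  refine Finset.sum_congr rfl fun j _ => ?_
  rw [sliceSum, Finset.mul_sum]
  refine Finset.sum_congr rfl fun e he => ?_
  obtain ⟨-, hej⟩ := Finset.mem_filter.mp he
  rw [slotCoeff_cons, hej]

/-- The distinguished slice is the block slice, cleared: `κ_{j₀} = D_ℓ · q(e₀)(s⃗)` (`j₀ = e₀`'s `ρ`-slot). -/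
theorem sliceSum_self_cast {P : MvPolynomial (Fin (k + 1) ⊕ Fin n) ℤ} {d : ℕ}
    (hdegl1 : ∀ e ∈ P.support, ∀ i : Fin k, e (Sum.inl i.succ) ≤ d) {pZ BZ : Fin k → ℤ}
    (hBpos : ∀ i, (0 : ℝ) < BZ i) {s : Fin k → ℝ} (hsp : ∀ i, s i = (pZ i : ℝ) / (BZ i : ℝ))
    (e₀ : Fin (k + 1) ⊕ Fin n →₀ ℕ) :
    ((sliceSum P d pZ BZ e₀ (e₀ (Sum.inl 0)) : ℤ) : ℝ) =
      (∏ i, ((BZ i : ℤ) : ℝ) ^ d) * MvPolynomial.eval s (blockSlice P e₀) := by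
  rw [sliceSum, blockSlice, map_sum]
  push_cast
  rw [Finset.mul_sum]
  refine Finset.sum_congr rfl fun e he => ?_
  have heS : e ∈ P.support := sliceSet_subset P e₀ (Finset.mem_filter.mp he).1
  rw [MvPolynomial.eval_monomial, Finsupp.prod_fintype _ _ (fun _ => pow_zero _)]
  simp only [Finsupp.tail_apply, lpart_apply]
  rw [slotCoeff_cast Fin.succ (fun i => hdegl1 e heS i) hBpos hsp]
  ring

/-- The height of the slices: `|κ_j| ≤ L · 2^d · D_ℓ` when `|p_i| ≤ 2 B_i`. -/
theorem sliceSum_abs {P : MvPolynomial (Fin (k + 1) ⊕ Fin n) ℤ} {d : ℕ}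
    (hdegl1 : ∀ e ∈ P.support, ∀ i : Fin k, e (Sum.inl i.succ) ≤ d)
    (hdegL1 : ∀ e ∈ P.support, ∑ i : Fin k, e (Sum.inl i.succ) ≤ d) {pZ BZ : Fin k → ℤ}
    (hBpos : ∀ i, (0 : ℝ) < BZ i) (hp_abs : ∀ i, |(pZ i : ℝ)| ≤ 2 * BZ i)
    (e₀ : Fin (k + 1) ⊕ Fin n →₀ ℕ) (j : ℕ) :
    |((sliceSum P d pZ BZ e₀ j : ℤ) : ℝ)| ≤
      (∑ e ∈ P.support, |((P.coeff e : ℤ) : ℝ)|) * 2 ^ d * ∏ i, ((BZ i : ℤ) : ℝ) ^ d := by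
  rw [sliceSum]; push_cast
  refine (Finset.abs_sum_le_sum_abs _ _).trans ?_
  have hsub : (sliceSet P e₀).filter (fun e => e (Sum.inl 0) = j) ⊆ P.support :=
    (Finset.filter_subset _ _).trans (sliceSet_subset P e₀)
  refine (Finset.sum_le_sum_of_subset_of_nonneg hsub (fun _ _ _ => abs_nonneg _)).trans ?_
  rw [Finset.sum_mul, Finset.sum_mul]
  refine Finset.sum_le_sum fun e he => ?_
  calc |((slotCoeff P d Fin.succ pZ BZ e : ℤ) : ℝ)|
      ≤ |((P.coeff e : ℤ) : ℝ)| * (2 ^ d * ∏ i, ((BZ i : ℤ) : ℝ) ^ d) :=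
        slotCoeff_abs Fin.succ (fun i => hdegl1 e he i) (hdegL1 e he) hBpos (by norm_num) hp_abs
    _ = |((P.coeff e : ℤ) : ℝ)| * 2 ^ d * ∏ i, ((BZ i : ℤ) : ℝ) ^ d := by ring

/-- **THE GAP** (the engine's rational-root step; tree Lemma A `mvspecialise_ne_zero_of_coprime` in the
`ρ`-slot): if the distinguished slice `κ_{j₀}` is non-zero, every `|κ_j| < q` and `gcd(a, q) = 1`, then the
cleared polynomial with slot `0 ↦ (a, q)` is non-zero. -/
theorem clearPoly_ne_zero_of_gap {P : MvPolynomial (Fin (k + 1) ⊕ Fin n) ℤ} {d : ℕ}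
    (hdegl0 : ∀ e ∈ P.support, e (Sum.inl 0) ≤ d) {e₀ : Fin (k + 1) ⊕ Fin n →₀ ℕ} (he₀ : e₀ ∈ P.support)
    {a : ℤ} {q : ℕ} (hcop : IsCoprime a (q : ℤ)) {pZ BZ : Fin k → ℤ}
    (hne : sliceSum P d pZ BZ e₀ (e₀ (Sum.inl 0)) ≠ 0) (hlt : ∀ j, |sliceSum P d pZ BZ e₀ j| < q) :
    clearPoly P d (Fin.cons a pZ) (Fin.cons (q : ℤ) BZ) ≠ 0 := by
  classical
  intro h0
  have hzero : ∑ j ∈ Finset.range (d + 1), (a ^ j * (q : ℤ) ^ (d - j)) * sliceSum P d pZ BZ e₀ j = 0 := by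
    rw [← coeff_clearPoly_regroup hdegl0, h0, MvPolynomial.coeff_zero]
  set Gs : Fin (d + 1) → MvPolynomial (Fin 0) ℤ := fun j => MvPolynomial.C (sliceSum P d pZ BZ e₀ j)
    with hGs
  have hG : ∃ j, Gs j ≠ 0 := by
    refine ⟨⟨e₀ (Sum.inl 0), Nat.lt_succ_of_le (hdegl0 e₀ he₀)⟩, ?_⟩
    simp only [hGs, ne_eq, MvPolynomial.C_eq_zero]
    exact hne
  have hlen : ∀ j, mvlen (Gs j) < q := by
    intro j
    have h1 : mvlen (Gs j) ≤ |sliceSum P d pZ BZ e₀ j| := by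
      simp only [hGs, MvPolynomial.C_apply]; exact mvlen_monomial_le'' _ _
    exact lt_of_le_of_lt h1 (hlt j)
  have hne' := mvspecialise_ne_zero_of_coprime Gs hG hcop hlen
  apply hne'
  have hspec : mvspecialise Gs a q =
      MvPolynomial.C (∑ j : Fin (d + 1), (a ^ (j : ℕ) * (q : ℤ) ^ (d - j)) * sliceSum P d pZ BZ e₀ j) := by
    simp only [mvspecialise, hGs, map_sum, map_mul]
  rw [hspec, Fin.sum_univ_eq_sum_range (fun j => (a ^ j * (q : ℤ) ^ (d - j)) * sliceSum P d pZ BZ e₀ j)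
    (d + 1), hzero, map_zero]

/-- A threshold `K ≥ N₀` with `x ≤ 2^K` and `y < 2^K`. -/
theorem exists_threshold (N₀ : ℕ) (x y : ℝ) : ∃ K : ℕ, N₀ ≤ K ∧ x ≤ 2 ^ K ∧ y < 2 ^ K := by
  have hM1 : ⌈x⌉₊ ≤ max N₀ (max ⌈x⌉₊ ⌈y⌉₊) := le_trans (le_max_left _ _) (le_max_right _ _)
  have hM2 : ⌈y⌉₊ ≤ max N₀ (max ⌈x⌉₊ ⌈y⌉₊) := le_trans (le_max_right _ _) (le_max_right _ _)
  have hM3 : ((max N₀ (max ⌈x⌉₊ ⌈y⌉₊) : ℕ) : ℝ) < (2 : ℝ) ^ (max N₀ (max ⌈x⌉₊ ⌈y⌉₊)) := by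
    exact_mod_cast Nat.lt_two_pow_self
  refine ⟨max N₀ (max ⌈x⌉₊ ⌈y⌉₊), le_max_left _ _, ?_, ?_⟩
  · have h1 : x ≤ ⌈x⌉₊ := Nat.le_ceil _
    have h2 : (⌈x⌉₊ : ℝ) ≤ ((max N₀ (max ⌈x⌉₊ ⌈y⌉₊) : ℕ) : ℝ) := by exact_mod_cast hM1
    linarith
  · have h1 : y ≤ ⌈y⌉₊ := Nat.le_ceil _
    have h2 : (⌈y⌉₊ : ℝ) ≤ ((max N₀ (max ⌈x⌉₊ ⌈y⌉₊) : ℕ) : ℝ) := by exact_mod_cast hM2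
    linarith

/-- The gap arithmetic: `L·2^d ≤ 2^N`, `0 < D_ℓ ≤ 2^{DW·N!}`, `DW + 1 ≤ A` and `2^{A·N!} < Q` give
`L·2^d·D_ℓ < Q` and `D_ℓ < Q`. -/
theorem gap_lt {L Dl Q : ℝ} {d N DW A : ℕ} (hL : L * 2 ^ d ≤ 2 ^ N) (hDl0 : 0 < Dl)
    (hDl_le : Dl ≤ (2 : ℝ) ^ (DW * N !)) (hA : DW + 1 ≤ A) (hF1 : (2 : ℝ) ^ (A * N !) < Q) :
    L * 2 ^ d * Dl < Q ∧ Dl < Q := by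
  have hNfac : N ≤ N ! := Nat.self_le_factorial N
  have h2N : (2 : ℝ) ^ N ≤ 2 ^ N ! := pow_le_pow_right₀ (by norm_num) hNfac
  have hpowA : N ! + DW * N ! ≤ A * N ! := by
    have e1 : N ! + DW * N ! = (DW + 1) * N ! := by ring
    rw [e1]
    exact Nat.mul_le_mul_right _ hA
  have h2 : (2 : ℝ) ^ N ! * (2 : ℝ) ^ (DW * N !) ≤ (2 : ℝ) ^ (A * N !) := by
    rw [← pow_add]
    exact pow_le_pow_right₀ (by norm_num) hpowA
  refine ⟨?_, ?_⟩
  · have h22 : (0 : ℝ) ≤ 2 ^ N ! := by positivity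
    have h1 : L * 2 ^ d * Dl ≤ 2 ^ N ! * (2 : ℝ) ^ (DW * N !) :=
      mul_le_mul (hL.trans h2N) hDl_le hDl0.le h22
    exact lt_of_le_of_lt (h1.trans h2) hF1
  · have h3 : (2 : ℝ) ^ (DW * N !) ≤ (2 : ℝ) ^ (A * N !) :=
      pow_le_pow_right₀ (by norm_num) (le_trans (Nat.le_add_left _ _) hpowA)
    exact lt_of_le_of_lt (hDl_le.trans h3) hF1

end Engine

end Summit.Schanuel.Schanuel.Theorems.RootDecomp1KGapCell
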